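import Summits.Ventures.GridStability.Models.RelativeSwingLFFOffDiag
import Summits.Ventures.GridStability.Models.RecastAngles
import Literature.MathematicalPhysics.PowerSystems.LyapunovFunctionFamilyClosedForm
import HarnessLib

/-!
# GridStability/Lyapunov/RelativeLffClosedForm — a SOLVER-FREE Vu–Turitsyn certificate for EVERY
# lossless network-reduced classical model with uniform damping and an acute equilibrium

Cell `gridfusion` (LADDER-GRIDFUSION), LFF lane (lead 2026-08-27T01:19:25Z P1/P2, 01:47:59Z; lit-6
register §9.14 «the same with μ = Fin 9 for NE39 … Sherman–Morrison gives N⁻¹ in closed form»); seat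
gridfusion-lyap-1 (g3); namespace `Summit.Ventures.GridStability.Lyapunov.RelativeLff`. GENERIC in the
instance: for ANY recast data `d : RecastData n` of model-1 (machines `0..n`, machine `0` the angle
reference) this file builds lit-6's closed-form member `Certificate.relativeClosedForm`
[cite: VuTuritsyn2016, §III eq. (QKH)] of the Lyapunov-function family for the relative system
`d.lffSystemOff lam δs` (= `System.relativeSwing`, model-1 `Models/RelativeSwingLFFOffDiag.lean`) with
NO numerical input beyond the data:

* `Ninv d = diag(M′) − (1/S)·M′M′ᵀ`, `M′_m = M_{m+1}`, `S = M_0 + Σ_m M′_m` — the Sherman–Morrison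
  inverse of `diag(1/M′) + (1/M_0)·𝟙𝟙ᵀ` (`Ninv_mul`, proved for every `M > 0`);
* `Ninv_sub_posSemidef` — `N⁻¹ − ν·1 ⪰ 0` for every `0 < ν < min M′` with the scalar criterion
  `Σ_m M′_m²/(M′_m − ν) ≤ S` (weighted Cauchy–Schwarz; per instance ONE rational inequality);
* `cert` — the certificate for every damping ratio `λ > 0` with `c = 1`, `g = λ/2`, `c′ = 2/λ + λ/2`
  (all scalar side conditions hold identically) and positive line weights (`Cc_ij > 0`, `i ≠ j`);
* `abs_δs_lt_of_acute` — if every machine's equilibrium angle relative to machine `0` lies in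
  `[0, π/2)` (circle points with `s_i ≥ 0`, `c_i > 0`), every line angle has `|θ*_i − θ*_j| < π/2`;
* `well_subset_regionOfAttraction` — lit-6's `relativeClosedForm_well_subset_regionOfAttraction`
  applied: for every level `c₀ < V(0) + c′·w_k·vtGap(θ*_k)` the set `{x ∈ 𝒫 | V x ≤ c₀}` is positively
  invariant and every global solution from it tends to `0`;
* `synchronisation_of_isSolutionOn` — read on model-1's typed model via
  `RecastData.hasDerivWithinAt_lffState_off`: every solution of `d.toModelRel lam a′` (lossless:
  `G_ij = 0` off the diagonal; reciprocal `B`; A1 data `EqData δs`) starting in that set synchronises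
  with the reference machine.

Instances are then one screen each (`Lyapunov/NE39LLffRoa.lean`: the 10-machine New England lossless
variant, `ν = 1/10`; the WSCC9 pilot `Lyapunov/WSCC9LffRoa.lean` was typed by hand before this file).
THREE COLUMNS: everything here is a theorem schema about MODEL M′ = lossless network-reduced classical
multimachine model with uniform damping `D_i = λM_i` (MV-2L + MV-λ; per instance + MV-RD/MV-h12);
CERTIFIED per instance = the scalar inequality for `ν`, `Cc > 0`, the sign facts of the circle points;
VALIDATED nothing. No sentence here says that any grid is stable. Definitions: `Mμ`, `Mref`, `S`,
`Ninv`, `cert` (bookkeeping); no named fact; standard axioms.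
-/

noncomputable section

open Set Filter Topology Real Matrix Finset
open Literature.MathematicalPhysics.PowerSystems
open Literature.MathematicalPhysics.PowerSystems.LyapunovFunctionFamily
open Literature.MathematicalPhysics.PowerSystems.ClassicalModel.LosslessSystem (vtGap)
open Summit.Ventures.GridStability.Models

namespace Summit.Ventures.GridStability.Lyapunov.RelativeLff

variable {n : ℕ} (d : RecastData n)

/-! ### Sherman–Morrison data -/

/-- Inertias of the non-reference machines, `M′_m = M_{m+1}`. -/
def Mμ (m : Fin n) : ℝ := (d.M m.succ : ℝ)

/-- Inertia of the reference machine, `M_0`. -/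
def Mref : ℝ := (d.M 0 : ℝ)

/-- `S = M_0 + Σ_m M′_m` (total inertia). -/
def S : ℝ := Mref d + ∑ m, Mμ d m

/-- **`N⁻¹ = diag(M′) − (1/S)·M′M′ᵀ`** — the Sherman–Morrison inverse of
`N = diag(1/M′) + (1/M_0)·𝟙𝟙ᵀ` (the matrix of `System.relativeSwing`'s `B_a`). -/
def Ninv : Matrix (Fin n) (Fin n) ℝ :=
  Matrix.diagonal (Mμ d) - (1 / S d) • Matrix.vecMulVec (Mμ d) (Mμ d)

/-- Entries of `N⁻¹`. -/
theorem Ninv_apply (i k : Fin n) :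
    Ninv d i k = (if i = k then Mμ d i else 0) - 1 / S d * (Mμ d i * Mμ d k) := by
  simp [Ninv, Matrix.diagonal_apply, Matrix.vecMulVec_apply]

/-- `N⁻¹` is symmetric. -/
theorem Ninv_transpose : (Ninv d)ᵀ = Ninv d := by
  ext i j
  rw [Matrix.transpose_apply, Ninv_apply, Ninv_apply]
  by_cases h : i = j
  · subst h; rfl
  · rw [if_neg h, if_neg (Ne.symm h)]; ring

/-- **Sherman–Morrison**: `N⁻¹ · (diag(1/M′) + (1/M_0)𝟙𝟙ᵀ) = 1` whenever all `M_i > 0`. -/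
theorem Ninv_mul (hM : ∀ i, 0 < d.M i) :
    Ninv d * (Matrix.diagonal (fun m => 1 / Mμ d m)
      + Matrix.of (fun (_ : Fin n) (_ : Fin n) => 1 / Mref d)) = 1 := by
  have hMμ : ∀ m, 0 < Mμ d m := fun m => by unfold Mμ; exact_mod_cast hM m.succ
  have hMref : 0 < Mref d := by unfold Mref; exact_mod_cast hM 0
  have hS : 0 < S d := by
    unfold S; exact add_pos_of_pos_of_nonneg hMref (Finset.sum_nonneg fun m _ => (hMμ m).le)
  set Nm : Matrix (Fin n) (Fin n) ℝ := Matrix.diagonal (fun m => 1 / Mμ d m)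
      + Matrix.of (fun (_ : Fin n) (_ : Fin n) => 1 / Mref d) with hNm
  have hN : ∀ k j, Nm k j = (if k = j then 1 / Mμ d k else 0) + 1 / Mref d := by
    intro k j; simp [hNm, Matrix.add_apply, Matrix.diagonal_apply]
  set T : ℝ := ∑ m, Mμ d m with hT
  have hST : S d = Mref d + T := rfl
  -- column sums of `N` weighted by `M′`
  have hcol : ∀ j, ∑ k, Mμ d k * Nm k j = 1 + T / Mref d := by
    intro j
    simp only [hN, mul_add, Finset.sum_add_distrib, mul_ite, mul_zero, Finset.sum_ite_eq',
      Finset.mem_univ, if_true]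
    rw [mul_one_div, div_self (hMμ j).ne', ← Finset.sum_mul, ← hT]
    ring
  ext i j
  rw [Matrix.mul_apply]
  have hsplit : ∀ k, Ninv d i k * Nm k j
      = (if i = k then Mμ d i * Nm k j else 0) - 1 / S d * Mμ d i * (Mμ d k * Nm k j) := by
    intro k
    rw [Ninv_apply]
    by_cases hik : i = k
    · subst hik; simp; ring
    · rw [if_neg hik, if_neg hik]; ring
  rw [Finset.sum_congr rfl fun k _ => hsplit k, Finset.sum_sub_distrib, Finset.sum_ite_eq,
    ← Finset.mul_sum, hcol j]
  simp only [Finset.mem_univ, if_true, hN]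
  by_cases hij : i = j
  · subst hij
    rw [if_pos rfl, Matrix.one_apply_eq, mul_add, mul_one_div, div_self (hMμ i).ne']
    field_simp
    rw [hST]; ring
  · rw [if_neg hij, Matrix.one_apply_ne hij, zero_add]
    field_simp
    rw [hST]; ring

/-- **`N⁻¹ − ν·1 ⪰ 0` from ONE scalar inequality** (weighted Cauchy–Schwarz): if `ν < M′_m` for
all `m` and `Σ_m M′_m²/(M′_m − ν) ≤ S`, then
`xᵀ(N⁻¹ − ν1)x = Σ (M′_m − ν)x_m² − (Σ M′_m x_m)²/S ≥ 0`. -/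
theorem Ninv_sub_posSemidef (hM : ∀ i, 0 < d.M i) {ν : ℝ} (hνM : ∀ m, ν < Mμ d m)
    (hCS : ∑ m, Mμ d m ^ 2 / (Mμ d m - ν) ≤ S d) :
    (Ninv d - ν • (1 : Matrix (Fin n) (Fin n) ℝ)).PosSemidef := by
  have hMref : 0 < Mref d := by unfold Mref; exact_mod_cast hM 0
  have hMμ : ∀ m, 0 < Mμ d m := fun m => by unfold Mμ; exact_mod_cast hM m.succ
  have hS : 0 < S d := by
    unfold S; exact add_pos_of_pos_of_nonneg hMref (Finset.sum_nonneg fun m _ => (hMμ m).le)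
  refine Matrix.PosSemidef.of_dotProduct_mulVec_nonneg ?_ fun x => ?_
  · rw [Matrix.IsHermitian, Matrix.conjTranspose_eq_transpose_of_trivial, Matrix.transpose_sub,
      Ninv_transpose, Matrix.transpose_smul, Matrix.transpose_one]
  · -- entries of `N⁻¹ − ν1`
    have hA : ∀ i j, (Ninv d - ν • (1 : Matrix (Fin n) (Fin n) ℝ)) i j
        = (if i = j then Mμ d i - ν else 0) - 1 / S d * (Mμ d i * Mμ d j) := by
      intro i j
      rw [Matrix.sub_apply, Matrix.smul_apply, Ninv_apply, Matrix.one_apply, smul_eq_mul]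
      by_cases h : i = j
      · subst h; simp; ring
      · rw [if_neg h, if_neg h, if_neg h]; ring
    set L : ℝ := ∑ j, Mμ d j * x j with hL
    have hrow : ∀ i, ∑ j, (Ninv d - ν • (1 : Matrix (Fin n) (Fin n) ℝ)) i j * x j
        = (Mμ d i - ν) * x i - 1 / S d * Mμ d i * L := by
      intro i
      have : ∀ j, (Ninv d - ν • (1 : Matrix (Fin n) (Fin n) ℝ)) i j * x j
          = (if i = j then (Mμ d i - ν) * x j else 0) - 1 / S d * Mμ d i * (Mμ d j * x j) := by
        intro j
        rw [hA]
        by_cases h : i = j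
        · subst h; simp; ring
        · rw [if_neg h, if_neg h]; ring
      rw [Finset.sum_congr rfl fun j _ => this j, Finset.sum_sub_distrib, Finset.sum_ite_eq,
        ← Finset.mul_sum, ← hL]
      simp
    have hq : star x ⬝ᵥ ((Ninv d - ν • (1 : Matrix (Fin n) (Fin n) ℝ)) *ᵥ x)
        = ∑ m, (Mμ d m - ν) * x m ^ 2 - 1 / S d * L ^ 2 := by
      simp only [star_trivial, dotProduct, Matrix.mulVec, dotProduct]
      have : ∀ i, x i * ∑ j, (Ninv d - ν • (1 : Matrix (Fin n) (Fin n) ℝ)) i j * x j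
          = (Mμ d i - ν) * x i ^ 2 - 1 / S d * L * (Mμ d i * x i) := by
        intro i; rw [hrow]; ring
      rw [Finset.sum_congr rfl fun i _ => this i, Finset.sum_sub_distrib, ← Finset.mul_sum, ← hL]
      ring
    rw [hq]
    -- weighted Cauchy–Schwarz: (Σ M x)² ≤ (Σ M²/(M−ν)) · Σ (M−ν) x²
    have hw : ∀ m, 0 < Mμ d m - ν := fun m => sub_pos.2 (hνM m)
    have hcs := Finset.sum_mul_sq_le_sq_mul_sq Finset.univ
      (fun m => Mμ d m / Real.sqrt (Mμ d m - ν)) (fun m => Real.sqrt (Mμ d m - ν) * x m)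
    have e1 : ∀ m, Mμ d m / Real.sqrt (Mμ d m - ν) * (Real.sqrt (Mμ d m - ν) * x m)
        = Mμ d m * x m := fun m => by
      have hs : Real.sqrt (Mμ d m - ν) ≠ 0 := (Real.sqrt_pos.2 (hw m)).ne'
      field_simp
    have e2 : ∀ m, (Mμ d m / Real.sqrt (Mμ d m - ν)) ^ 2 = Mμ d m ^ 2 / (Mμ d m - ν) := fun m => by
      rw [div_pow, Real.sq_sqrt (hw m).le]
    have e3 : ∀ m, (Real.sqrt (Mμ d m - ν) * x m) ^ 2 = (Mμ d m - ν) * x m ^ 2 := fun m => by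
      rw [mul_pow, Real.sq_sqrt (hw m).le]
    simp only [e1, e2, e3] at hcs
    rw [← hL] at hcs
    have hP : 0 ≤ ∑ m, (Mμ d m - ν) * x m ^ 2 := Finset.sum_nonneg fun m _ => by
      have := hw m; positivity
    have hkey : L ^ 2 ≤ S d * ∑ m, (Mμ d m - ν) * x m ^ 2 :=
      hcs.trans (mul_le_mul_of_nonneg_right hCS hP)
    have : 1 / S d * L ^ 2 ≤ ∑ m, (Mμ d m - ν) * x m ^ 2 := by
      rw [one_div_mul_eq_div, div_le_iff₀ hS]
      linarith
    linarith

/-! ### The system and the certificate member -/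

/-- `d.lffSystemOff lam δs` is lit-6's `relativeSwing` on the data `Mμ d`, `Mref d` (definitional). -/
theorem lffSystemOff_eq (lam : ℚ) (δs : Fin (n + 1) → ℝ) :
    d.lffSystemOff lam δs = System.relativeSwing (Mμ d) (Mref d) (lam : ℝ) (RecastData.lffEo n)
      d.lffWo (RecastData.lffδso δs) := rfl

/-- **The closed-form Vu–Turitsyn certificate of ANY lossless uniform-λ recast model**, for every
damping ratio `λ > 0`: `Q = [[λ·N⁻¹, N⁻¹], [N⁻¹, c′·N⁻¹]]`, `K = c′·w`, `H = w`, `ε = νλ/2` with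
`c = 1`, `g = λ/2`, `c′ = 2/λ + λ/2` (so `c ≤ λc′`, `0 < g < λc`, `c² ≤ (λc − g)(c′ − g)` hold for
all `λ > 0`). Instance input: `M > 0`, a margin `0 < ν < min M′` with `Σ M′²/(M′ − ν) ≤ S`, and
positive couplings `Cc_ij > 0` (`i ≠ j`). Type inferred: `Certificate (System.relativeSwing (Mμ d) …)`
(`= Certificate (d.lffSystemOff lam δs)` by `lffSystemOff_eq`). [cite: VuTuritsyn2016, §III eq. (QKH)] -/
def cert (lam : ℚ) (hlam : 0 < lam) (δs : Fin (n + 1) → ℝ) {ν : ℝ} (hν : 0 < ν)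
    (hM : ∀ i, 0 < d.M i) (hνM : ∀ m, ν < Mμ d m) (hCS : ∑ m, Mμ d m ^ 2 / (Mμ d m - ν) ≤ S d)
    (hC : ∀ i j : Fin (n + 1), i ≠ j → 0 < d.Cc i j) :=
  Certificate.relativeClosedForm (Mμ d) (Mref d) (lam : ℝ) (RecastData.lffEo n) d.lffWo
    (RecastData.lffδso δs) (Ninv d) 1 (2 / (lam : ℝ) + (lam : ℝ) / 2) ν ((lam : ℝ) / 2)
    (Ninv_mul d hM) (Ninv_transpose d) hν (Ninv_sub_posSemidef d hM hνM hCS) (d.lffWo_pos hC)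
    (by exact_mod_cast hlam) one_pos
    (by have : (0 : ℝ) < lam := by exact_mod_cast hlam
        positivity)
    (by have h : (0 : ℝ) < lam := by exact_mod_cast hlam
        rw [mul_add, mul_div_cancel₀ _ h.ne']; nlinarith)
    (by have : (0 : ℝ) < lam := by exact_mod_cast hlam
        positivity)
    (by have h : (0 : ℝ) < lam := by exact_mod_cast hlam
        linarith)
    (by have h : (0 : ℝ) < lam := by exact_mod_cast hlam
        have e : ((lam : ℝ) * 1 - (lam : ℝ) / 2) * (2 / (lam : ℝ) + (lam : ℝ) / 2 - (lam : ℝ) / 2) = 1 := by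
          field_simp; ring
        rw [e]; norm_num)

/-! ### Equilibrium line angles inside the polytope -/

/-- If all equilibrium angles lie in a half-open window of width `≤ π/2`, every line angle
`θ*_i − θ*_j` has modulus `< π/2`. -/
theorem abs_δs_lt_of_window {δs : Fin (n + 1) → ℝ} {lo hi : ℝ} (hw : hi - lo ≤ π / 2)
    (hθ : ∀ i, lo ≤ δs i ∧ δs i < hi) (k : RecastData.LffPair n) :
    |RecastData.lffδso δs k| < π / 2 := by
  show |δs k.1.1 - δs k.1.2| < π / 2
  have h1 := hθ k.1.1
  have h2 := hθ k.1.2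
  rw [abs_lt]; constructor <;> linarith

/-- Every angle `θ*_i = angleOf i` of ACUTE circle data (`s_i ≥ 0`, `c_i > 0`) lies in `[0, π/2)`
(`θ*_i = arccos c_i`). -/
theorem angleOf_mem_of_acute (hs : ∀ i, 0 ≤ d.s i) (hc : ∀ i, 0 < d.c i) (i : Fin (n + 1)) :
    0 ≤ d.angleOf i ∧ d.angleOf i < π / 2 := by
  have h1 : d.angleOf i = Real.arccos ((d.c i : ℚ) : ℝ) := by
    unfold RecastData.angleOf; rw [if_pos (hs i)]
  rw [h1]
  refine ⟨Real.arccos_nonneg _, ?_⟩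
  rw [Real.arccos_lt_pi_div_two]
  exact_mod_cast hc i

/-- **Acute data ⇒ equilibrium line angles inside the Vu–Turitsyn polytope**: `|θ*_i − θ*_j| < π/2`
on every ordered machine pair. -/
theorem abs_δs_lt_of_acute (hs : ∀ i, 0 ≤ d.s i) (hc : ∀ i, 0 < d.c i) (k : RecastData.LffPair n) :
    |RecastData.lffδso d.angleOf k| < π / 2 :=
  abs_δs_lt_of_window (lo := 0) (hi := π / 2) (by linarith)
    (fun i => angleOf_mem_of_acute d hs hc i) k

/-! ### THE CERTIFIED REGION (symbolic level), generic in the instance -/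

/-- **The certified synchronisation region of a lossless uniform-λ recast model, from the closed-form
Vu–Turitsyn certificate** ([cite: VuTuritsyn2016, §IV set ℛ]). For every `λ > 0`, every instance
input of `cert`, equilibrium line angles with `|θ*_i − θ*_j| < π/2`, every level
`c₀ < V(0) + c′·w_k·vtGap(θ*_k)` on all ordered machine pairs `k`, and every relative state `y` in the
polytope `𝒫` with `V y ≤ c₀`: a global solution of the relative field (`= (d.lffSystemOff lam δs).field`,
`lffSystemOff_eq`) exists, and EVERY global solution keeps `{𝒫, V ≤ c₀}` and tends to `0`. MODELLED:
lossless network-reduced classical model with uniform damping (MV-2L + MV-λ). No solver. -/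
theorem well_subset_regionOfAttraction (lam : ℚ) (hlam : 0 < lam) {δs : Fin (n + 1) → ℝ} {ν : ℝ}
    (hν : 0 < ν) (hM : ∀ i, 0 < d.M i) (hνM : ∀ m, ν < Mμ d m)
    (hCS : ∑ m, Mμ d m ^ 2 / (Mμ d m - ν) ≤ S d) (hC : ∀ i j : Fin (n + 1), i ≠ j → 0 < d.Cc i j)
    (hδs : ∀ k, |RecastData.lffδso δs k| < π / 2) {c₀ : ℝ}
    (hc₀ : ∀ k, c₀ < (cert d lam hlam δs hν hM hνM hCS hC).V 0
      + (2 / (lam : ℝ) + (lam : ℝ) / 2) * d.lffWo k * vtGap (RecastData.lffδso δs k))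
    {y : Fin n ⊕ Fin n → ℝ}
    (hy : y ∈ (System.relativeSwing (Mμ d) (Mref d) (lam : ℝ) (RecastData.lffEo n) d.lffWo
      (RecastData.lffδso δs)).polytope)
    (hyc : (cert d lam hlam δs hν hM hνM hCS hC).V y ≤ c₀) :
    (∃ X : ℝ → Fin n ⊕ Fin n → ℝ, X 0 = y ∧
        ∀ T : ℝ, ∀ t ∈ Icc 0 T, HasDerivWithinAt X
          ((System.relativeSwing (Mμ d) (Mref d) (lam : ℝ) (RecastData.lffEo n) d.lffWo
            (RecastData.lffδso δs)).field (X t)) (Icc 0 T) t) ∧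
      ∀ X : ℝ → Fin n ⊕ Fin n → ℝ, X 0 = y →
        (∀ T : ℝ, ∀ t ∈ Icc 0 T, HasDerivWithinAt X
          ((System.relativeSwing (Mμ d) (Mref d) (lam : ℝ) (RecastData.lffEo n) d.lffWo
            (RecastData.lffδso δs)).field (X t)) (Icc 0 T) t) →
        (∀ t, 0 ≤ t → X t ∈ (System.relativeSwing (Mμ d) (Mref d) (lam : ℝ) (RecastData.lffEo n)
            d.lffWo (RecastData.lffδso δs)).polytope ∧
            (cert d lam hlam δs hν hM hνM hCS hC).V (X t) ≤ c₀) ∧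
          Tendsto X atTop (𝓝 0) :=
  Certificate.relativeClosedForm_well_subset_regionOfAttraction (Mμ d) (Mref d) (lam : ℝ)
    (RecastData.lffEo n) d.lffWo (RecastData.lffδso δs) (Ninv d) 1 (2 / (lam : ℝ) + (lam : ℝ) / 2)
    ν ((lam : ℝ) / 2) _ _ _ _ _ _ _ _ _ _ _ _ RecastData.lffEo_injective_aux hδs hc₀ hy hyc

/-- **The same read on model-1's typed classical model.** For every `λ > 0`, every common
acceleration `a′`, LOSSLESS reciprocal data (`G_ij = 0` for `i ≠ j`, `B` symmetric) faithful at the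
angles `δs` (`EqData`), every level `c₀` as above and EVERY solution `c` of `d.toModelRel lam a′` on
`univ` whose initial relative state `x(0) = ((δ_m − δ_0) − (θ*_m − θ*_0), ω_m − ω_0)_m` lies in the
polytope with `V(x(0)) ≤ c₀`: the relative state keeps `{𝒫, V ≤ c₀}` for all `t ≥ 0` and tends to
`0` — every machine synchronises with the reference machine `0` at the relative angles `θ*`.
MODELLED as above; no sentence here says a grid is stable.
[cite: VuTuritsyn2016, §IV set ℛ; SauerPai1998, §6.10 eqs. (6.238)–(6.241)] -/
theorem synchronisation_of_isSolutionOn (lam : ℚ) (hlam : 0 < lam) (a : ℝ)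
    (hG : ∀ i j, i ≠ j → d.G i j = 0) (hB : ∀ i j, d.B i j = d.B j i) {δs : Fin (n + 1) → ℝ}
    (hEq : d.EqData δs) {ν : ℝ} (hν : 0 < ν) (hM : ∀ i, 0 < d.M i) (hνM : ∀ m, ν < Mμ d m)
    (hCS : ∑ m, Mμ d m ^ 2 / (Mμ d m - ν) ≤ S d) (hC : ∀ i j : Fin (n + 1), i ≠ j → 0 < d.Cc i j)
    (hδs : ∀ k, |RecastData.lffδso δs k| < π / 2) {c₀ : ℝ}
    (hc₀ : ∀ k, c₀ < (cert d lam hlam δs hν hM hνM hCS hC).V 0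
      + (2 / (lam : ℝ) + (lam : ℝ) / 2) * d.lffWo k * vtGap (RecastData.lffδso δs k))
    {c : ℝ → ClassicalSwing.State (n + 1)} (hc : (d.toModelRel lam a).IsSolutionOn c univ)
    (hy : RecastData.lffState δs (c 0) ∈ (System.relativeSwing (Mμ d) (Mref d) (lam : ℝ)
      (RecastData.lffEo n) d.lffWo (RecastData.lffδso δs)).polytope)
    (hyc : (cert d lam hlam δs hν hM hνM hCS hC).V (RecastData.lffState δs (c 0)) ≤ c₀) :
    (∀ t, 0 ≤ t →
        RecastData.lffState δs (c t) ∈ (System.relativeSwing (Mμ d) (Mref d) (lam : ℝ)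
          (RecastData.lffEo n) d.lffWo (RecastData.lffδso δs)).polytope ∧
          (cert d lam hlam δs hν hM hνM hCS hC).V (RecastData.lffState δs (c t)) ≤ c₀) ∧
      Tendsto (fun t => RecastData.lffState δs (c t)) atTop (𝓝 0) := by
  obtain ⟨-, hall⟩ := well_subset_regionOfAttraction d lam hlam hν hM hνM hCS hC hδs hc₀ hy hyc
  refine hall (fun t => RecastData.lffState δs (c t)) rfl fun T t _ => ?_
  have h := (d.hasDerivWithinAt_lffState_off lam a hG hB hEq (fun i => (hM i).ne') hc
    (mem_univ t)).mono (subset_univ (Icc 0 T))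
  rw [lffSystemOff_eq] at h
  exact h

end Summit.Ventures.GridStability.Lyapunov.RelativeLff

end
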